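import Literature.Computability.QuantumComplexity.ReversibleCliffordT
import HarnessLib

/-!
# Classical reversible gadgets: `NOT`/`CNOT`/Toffoli programs over an abstract wire type

Toolkit for tableau-style reversible simulations (the reversible core of `BPP ⊆ BQP`,
Bernstein–Vazirani 1997, Thm. 8.3; Arora–Barak 2009, Lemma 10.10: "replace each Boolean gate
by its quantum analog", i.e. by `NOT`, `CNOT` and Toffoli gates acting on fresh ancilla wires;
Nielsen–Chuang 2010, §3.2.5, reversible classical computation with the Toffoli gate).

A *classical reversible operation* `ClOp ι` over a wire type `ι` is `not i`, `cnot i j`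
(`j ← j ⊕ i`) or `toffoli a b c` (`c ← c ⊕ ab`); its semantics on wire assignments
`w : ι → Bool` is `eval op w = update w op.target (w op.target ⊕ op.guard w)` where the
*guard* is the conjunction of the control wires. A program is a list, executed head first
(`clEval`). The wire type is arbitrary (with decidable equality), so that structured index
types (sums and products of `Fin`s) can be used for bookkeeping and transported to `Fin N`
at the end (`clEval_map_equiv`).

Relation to `ReversibleCliffordT`: there, `RevOp N` is the same syntax on the wires `Fin N`
*with the distinctness proofs built into the constructors* (what the Clifford+T words need),
`revEval` its semantics and `revCompile` the compiler into Clifford+T. `ClOp ι` is the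
proof-free bookkeeping layer over an arbitrary wire type; the single path from `ClOp`
programs to `revCompile` is the bridge at the end of this file: a well-formed operation on
`Fin N` is a reversible operation (`ClOp.toRev`, `toRevList`) with the same semantics
(`ClOp.eval_toRev`, `revEval_toRevList : revEval (toRevList ops h) = clEval ops`).

Main lemmas (all elementary):

* `clEval_apply_of_forall_target_ne`: a wire that is never a target keeps its value;
* `clEval_apply_of_disjoint`: if no target of the program is a control of the program, then
  every wire is toggled by the XOR, over the operations targeting it, of their guards
  evaluated on the *initial* assignment; corollaries `clEval_apply_target_of_nodup` (each
  target hit once) and `clEval_eq_self_of_guard` (all guards off: identity);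
* `clChain`/`clEval_clChain_getLast`/`clEval_clChain_getElem`: the Toffoli chain
  `aᵢ₊₁ ← aᵢ ∧ lᵢ` on fresh ancillas computes the conjunction of the literals `lᵢ` (and of
  the seed wire) into the last ancilla, changing nothing else (`clEval_clChain_of_not_mem`);
* `clToggle`: the XOR of the initial guards of the operations targeting a wire;
* `ClOp.map`, `clEval_map_apply`, `clEval_map_apply_of_not_mem_range`, `clEval_map_equiv`:
  transport along injective re-indexings of the wires;
* `ClOp.eval_involutive`, `clEval_injective`: reversibility;
* `ClOp.toRev`, `toRevList`, `revEval_toRevList`: the bridge to `RevOp`/`revCompile`.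

## References

* S. Arora, B. Barak, *Computational Complexity: A Modern Approach*, CUP 2009, §10.3.7,
  Lemma 10.10 (Boolean circuits from `NOT`, `CNOT`, Toffoli on fresh wires).
* M. A. Nielsen, I. L. Chuang, *Quantum Computation and Quantum Information*, CUP 2010,
  §3.2.5 (Toffoli gate, reversible simulation of classical gates with ancillas).
* E. Bernstein, U. Vazirani, *Quantum complexity theory*, SIAM J. Comput. 26 (1997), Thm. 8.3.
-/

namespace Literature.Computability.QuantumComplexity

open Function

/-- A classical reversible operation on wires of type `ι`: `NOT` on a wire, `CNOT`
(target `j ← j ⊕ i`), Toffoli (target `c ← c ⊕ ab`). No distinctness of the wires is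
required by the syntax (`ClOp.WF` records it). [Nielsen–Chuang 2010, §3.2.5; Arora–Barak
2009, §10.3.7, Lemma 10.10] [cite: NielsenChuang2010, §3.2.5] -/
inductive ClOp (ι : Type*)
  /-- `NOT` on wire `i`. -/
  | not (i : ι)
  /-- `CNOT` with control `i` and target `j`. -/
  | cnot (i j : ι)
  /-- Toffoli with controls `a, b` and target `c`. -/
  | toffoli (a b c : ι)
  deriving DecidableEq

namespace ClOp

variable {ι κ : Type*}

/-- The target wire of an operation. [folklore] -/
def target : ClOp ι → ι
  | not i => i
  | cnot _ j => j
  | toffoli _ _ c => c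

/-- The control wires of an operation. [folklore] -/
def controls : ClOp ι → List ι
  | not _ => []
  | cnot i _ => [i]
  | toffoli a b _ => [a, b]

/-- The guard of an operation on an assignment: the conjunction of its control wires
(`true` for `NOT`). [folklore] -/
def guard : ClOp ι → (ι → Bool) → Bool
  | not _, _ => true
  | cnot i _, w => w i
  | toffoli a b _, w => w a && w b

/-- An operation is well formed if its wires are pairwise distinct. [folklore] -/
def WF : ClOp ι → Prop
  | not _ => True
  | cnot i j => i ≠ j
  | toffoli a b c => a ≠ b ∧ a ≠ c ∧ b ≠ c

/-- Well-formedness is decidable. -/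
instance instDecidableWF [DecidableEq ι] (op : ClOp ι) : Decidable op.WF := by
  cases op <;> unfold WF <;> infer_instance

/-- Re-indexing the wires of an operation along `f : ι → κ`. [folklore] -/
def map (f : ι → κ) : ClOp ι → ClOp κ
  | not i => not (f i)
  | cnot i j => cnot (f i) (f j)
  | toffoli a b c => toffoli (f a) (f b) (f c)

/-- Target of a re-indexed operation. [folklore] -/
@[simp] theorem target_map (f : ι → κ) (op : ClOp ι) : (op.map f).target = f op.target := by
  cases op <;> rfl

/-- Controls of a re-indexed operation. [folklore] -/
@[simp] theorem controls_map (f : ι → κ) (op : ClOp ι) :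
    (op.map f).controls = op.controls.map f := by
  cases op <;> rfl

/-- Guard of a re-indexed operation. [folklore] -/
@[simp] theorem guard_map (f : ι → κ) (op : ClOp ι) (w : κ → Bool) :
    (op.map f).guard w = op.guard (w ∘ f) := by
  cases op <;> rfl

/-- Re-indexing along an injective map preserves well-formedness. [folklore] -/
theorem WF.map {f : ι → κ} (hf : Injective f) {op : ClOp ι} (h : op.WF) : (op.map f).WF := by
  cases op with
  | not i => trivial
  | cnot i j => exact fun e => h (hf e)
  | toffoli a b c =>
    obtain ⟨h1, h2, h3⟩ := h
    exact ⟨fun e => h1 (hf e), fun e => h2 (hf e), fun e => h3 (hf e)⟩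

/-- The guard only depends on the values of the control wires. [folklore] -/
theorem guard_congr (op : ClOp ι) {w w' : ι → Bool} (h : ∀ c ∈ op.controls, w c = w' c) :
    op.guard w = op.guard w' := by
  cases op with
  | not i => rfl
  | cnot i j => exact h i (by simp [controls])
  | toffoli a b c =>
    simp only [guard]
    rw [h a (by simp [controls]), h b (by simp [controls])]

variable [DecidableEq ι]

/-- **Semantics of an operation**: toggle the target by the guard.
[Nielsen–Chuang 2010, §3.2.5] [cite: NielsenChuang2010, §3.2.5] -/
def eval (op : ClOp ι) (w : ι → Bool) : ι → Bool :=
  update w op.target (w op.target ^^ op.guard w)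

/-- Value of the target after the operation. [folklore] -/
@[simp] theorem eval_apply_target (op : ClOp ι) (w : ι → Bool) :
    op.eval w op.target = (w op.target ^^ op.guard w) := by
  simp [eval]

/-- Wires other than the target are unchanged. [folklore] -/
theorem eval_apply_of_ne (op : ClOp ι) (w : ι → Bool) {i : ι} (h : i ≠ op.target) :
    op.eval w i = w i := by
  simp [eval, h]

/-- Pointwise form of `eval`. [folklore] -/
theorem eval_apply (op : ClOp ι) (w : ι → Bool) (i : ι) :
    op.eval w i = (w i ^^ (decide (op.target = i) && op.guard w)) := by
  by_cases h : op.target = i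
  · subst h; simp
  · rw [eval_apply_of_ne op w (Ne.symm h)]; simp [h]

/-- An operation whose guard is off is the identity. [folklore] -/
theorem eval_of_guard (op : ClOp ι) (w : ι → Bool) (h : op.guard w = false) : op.eval w = w := by
  funext i
  rw [eval_apply, h]
  simp

/-- `NOT` semantics: `w[i ↦ ¬ w i]`. [folklore] -/
theorem eval_not (i : ι) (w : ι → Bool) : (not i).eval w = update w i (!w i) := by
  simp [eval, target, guard]

/-- `CNOT` semantics: `w[j ↦ w j ⊕ w i]`. [folklore] -/
theorem eval_cnot (i j : ι) (w : ι → Bool) : (cnot i j).eval w = update w j (w j ^^ w i) := rfl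

/-- Toffoli semantics: `w[c ↦ w c ⊕ (w a ∧ w b)]`. [folklore] -/
theorem eval_toffoli (a b c : ι) (w : ι → Bool) :
    (toffoli a b c).eval w = update w c (w c ^^ (w a && w b)) := rfl

/-- A well-formed operation is an involution (its guard does not read the target).
[Nielsen–Chuang 2010, §3.2.5] [cite: NielsenChuang2010, §3.2.5] -/
theorem eval_involutive {op : ClOp ι} (h : op.WF) : Involutive (op.eval) := by
  intro w
  have hg : op.guard (op.eval w) = op.guard w := by
    refine guard_congr op fun c hc => eval_apply_of_ne op w ?_
    cases op with
    | not i => simp [controls] at hc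
    | cnot i j => simp only [controls, List.mem_singleton] at hc; subst hc; exact h
    | toffoli a b c' =>
      simp only [controls, List.mem_cons, List.not_mem_nil, or_false] at hc
      rcases hc with rfl | rfl
      · exact h.2.1
      · exact h.2.2
  funext i
  rw [eval_apply, hg, eval_apply]
  cases w i <;> cases decide (op.target = i) <;> cases op.guard w <;> rfl

/-- Re-indexing along an injective map commutes with the semantics on the image wires.
[folklore] -/
theorem eval_map_comp {f : ι → κ} [DecidableEq κ] (hf : Injective f) (op : ClOp ι)
    (w : κ → Bool) : (op.map f).eval w ∘ f = op.eval (w ∘ f) := by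
  unfold eval
  rw [target_map, guard_map, update_comp_eq_of_injective _ hf]
  rfl

omit [DecidableEq ι] in
/-- Re-indexed operations do not touch wires outside the image. [folklore] -/
theorem eval_map_apply_of_not_mem_range {f : ι → κ} [DecidableEq κ] (op : ClOp ι)
    (w : κ → Bool) {j : κ} (hj : j ∉ Set.range f) : (op.map f).eval w j = w j := by
  apply eval_apply_of_ne
  rw [target_map]
  rintro rfl
  exact hj ⟨_, rfl⟩

end ClOp

/-! ### Programs -/

/-- `List.all` only depends on the values of the predicate on the members of the list
(core's `List.all_congr` wants equal predicates). [folklore] -/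
theorem _root_.List.all_congr_of_forall_mem {α : Type*} {l : List α} {p q : α → Bool}
    (h : ∀ a ∈ l, p a = q a) : l.all p = l.all q := by
  induction l with
  | nil => rfl
  | cons a l ih =>
    rw [List.all_cons, List.all_cons, h a (by simp), ih fun b hb => h b (by simp [hb])]

section Chain

variable {ι : Type*}

/-- The Toffoli chain with seed wire `a₀`, literals `l₁, …, lᵣ` and ancillas `a₁, …, aᵣ`:
`a₁ ← a₁ ⊕ a₀ l₁`, `a₂ ← a₂ ⊕ a₁ l₂`, … . On fresh (zero) ancillas it computes
`aᵢ = a₀ ∧ l₁ ∧ ⋯ ∧ lᵢ`. (Surplus literals or ancillas are ignored.) [Nielsen–Chuang 2010,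
§3.2.5 (AND via Toffoli with an ancilla); Arora–Barak 2009, Lemma 10.10]
[cite: NielsenChuang2010, §3.2.5] -/
def clChain (a₀ : ι) : List ι → List ι → List (ClOp ι)
  | l :: ls, a :: as => ClOp.toffoli a₀ l a :: clChain a ls as
  | _, _ => []

/-- `clChain` with no literals is empty. [folklore] -/
@[simp] theorem clChain_nil_left (a₀ : ι) (as : List ι) : clChain a₀ [] as = [] := by
  cases as <;> rfl

/-- `clChain` with no ancillas is empty. [folklore] -/
@[simp] theorem clChain_nil_right (a₀ : ι) (ls : List ι) : clChain a₀ ls [] = [] := by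
  cases ls <;> rfl

/-- Unfolding one link of the chain. [folklore] -/
@[simp] theorem clChain_cons_cons (a₀ l a : ι) (ls as : List ι) :
    clChain a₀ (l :: ls) (a :: as) = ClOp.toffoli a₀ l a :: clChain a ls as := rfl

/-- Every operation of a chain targets an ancilla. [folklore] -/
theorem target_mem_of_mem_clChain {a₀ : ι} {ls as : List ι} {op : ClOp ι}
    (h : op ∈ clChain a₀ ls as) : op.target ∈ as := by
  induction ls generalizing a₀ as with
  | nil => simp at h
  | cons l ls ih =>
    cases as with
    | nil => simp at h
    | cons a as =>
      rw [clChain_cons_cons, List.mem_cons] at h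
      rcases h with rfl | h
      · exact List.mem_cons_self ..
      · exact List.mem_cons_of_mem _ (ih h)

/-- The length of a chain is the number of literals when there are enough ancillas.
[folklore] -/
theorem length_clChain {a₀ : ι} {ls as : List ι} (h : ls.length ≤ as.length) :
    (clChain a₀ ls as).length = ls.length := by
  induction ls generalizing a₀ as with
  | nil => simp
  | cons l ls ih =>
    cases as with
    | nil => simp at h
    | cons a as =>
      rw [clChain_cons_cons, List.length_cons, List.length_cons, ih (by simpa using h)]

/-- Links of a conjunction chain on ancillas disjoint from the seed and the literals have
pairwise distinct wires. [folklore] -/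
theorem wf_of_mem_clChain {a₀ : ι} {ls as : List ι} (hnd : as.Nodup) (h0 : a₀ ∉ as)
    (hls : ∀ l ∈ ls, l ∉ as ∧ l ≠ a₀) {op : ClOp ι} (hop : op ∈ clChain a₀ ls as) : op.WF := by
  induction ls generalizing a₀ as with
  | nil => simp at hop
  | cons l ls ih =>
    cases as with
    | nil => simp at hop
    | cons a as =>
      rw [clChain_cons_cons, List.mem_cons] at hop
      rw [List.nodup_cons] at hnd
      rcases hop with rfl | hop
      · obtain ⟨hla, hl0⟩ := hls l (by simp)
        exact ⟨fun e => hl0 e.symm, fun e => h0 (e ▸ List.mem_cons_self ..),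
          fun e => hla (e ▸ List.mem_cons_self ..)⟩
      · refine ih hnd.2 hnd.1 (fun l' hl' => ?_) hop
        obtain ⟨h1, -⟩ := hls l' (by simp [hl'])
        exact ⟨fun h => h1 (List.mem_cons_of_mem _ h), fun e => h1 (e ▸ List.mem_cons_self ..)⟩

end Chain

section Programs

variable {ι κ : Type*} [DecidableEq ι]

/-- **Semantics of a reversible program** (a list of operations, head executed first).
[Nielsen–Chuang 2010, §3.2.5] [cite: NielsenChuang2010, §3.2.5] -/
def clEval : List (ClOp ι) → (ι → Bool) → ι → Bool
  | [], w => w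
  | op :: ops, w => clEval ops (op.eval w)

/-- The empty program is the identity. [folklore] -/
@[simp] theorem clEval_nil (w : ι → Bool) : clEval [] w = w := rfl

/-- Executing a program starting with `op`. [folklore] -/
@[simp] theorem clEval_cons (op : ClOp ι) (ops : List (ClOp ι)) (w : ι → Bool) :
    clEval (op :: ops) w = clEval ops (op.eval w) := rfl

/-- Executing a concatenation. [folklore] -/
theorem clEval_append (ops ops' : List (ClOp ι)) (w : ι → Bool) :
    clEval (ops ++ ops') w = clEval ops' (clEval ops w) := by
  induction ops generalizing w with
  | nil => rfl
  | cons op ops ih => exact ih _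

/-- Executing a `flatMap`, one chunk after the other (`foldl` form). [folklore] -/
theorem clEval_flatMap {α : Type*} (l : List α) (f : α → List (ClOp ι)) (w : ι → Bool) :
    clEval (l.flatMap f) w = l.foldl (fun w a => clEval (f a) w) w := by
  induction l generalizing w with
  | nil => rfl
  | cons a l ih => rw [List.flatMap_cons, clEval_append, List.foldl_cons, ih]

/-- **A wire that is never a target keeps its value.** [folklore] -/
theorem clEval_apply_of_forall_target_ne (ops : List (ClOp ι)) (w : ι → Bool) {i : ι}
    (h : ∀ op ∈ ops, op.target ≠ i) : clEval ops w i = w i := by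
  induction ops generalizing w with
  | nil => rfl
  | cons op ops ih =>
    rw [clEval_cons, ih _ (fun op' hop' => h op' (List.mem_cons_of_mem _ hop')),
      ClOp.eval_apply_of_ne op w (h op (by simp)).symm]

/-- The total toggle applied to wire `i` by a program whose guards are all evaluated on the
same assignment `w`: XOR over the operations targeting `i` of their guards. [folklore] -/
def clToggle (ops : List (ClOp ι)) (w : ι → Bool) (i : ι) : Bool :=
  (ops.map fun op => decide (op.target = i) && op.guard w).foldr Bool.xor false

/-- `clToggle` of the empty program. [folklore] -/
@[simp] theorem clToggle_nil (w : ι → Bool) (i : ι) : clToggle [] w i = false := rfl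

/-- `clToggle` of a program starting with `op`. [folklore] -/
@[simp] theorem clToggle_cons (op : ClOp ι) (ops : List (ClOp ι)) (w : ι → Bool) (i : ι) :
    clToggle (op :: ops) w i = ((decide (op.target = i) && op.guard w) ^^ clToggle ops w i) := rfl

/-- `clToggle` only depends on the values of the control wires. [folklore] -/
theorem clToggle_congr (ops : List (ClOp ι)) {w w' : ι → Bool} (i : ι)
    (h : ∀ op ∈ ops, ∀ c ∈ op.controls, w c = w' c) : clToggle ops w i = clToggle ops w' i := by
  induction ops with
  | nil => rfl
  | cons op ops ih =>
    rw [clToggle_cons, clToggle_cons, ClOp.guard_congr op (h op (by simp)),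
      ih fun op' hop' => h op' (List.mem_cons_of_mem _ hop')]

/-- If no operation targets `i`, the toggle of `i` vanishes. [folklore] -/
theorem clToggle_eq_false_of_forall_ne (ops : List (ClOp ι)) (w : ι → Bool) {i : ι}
    (h : ∀ op ∈ ops, op.target ≠ i) : clToggle ops w i = false := by
  induction ops with
  | nil => rfl
  | cons op ops ih =>
    rw [clToggle_cons, ih fun op' hop' => h op' (List.mem_cons_of_mem _ hop')]
    simp [h op (by simp)]

/-- If all guards are off, all toggles vanish. [folklore] -/
theorem clToggle_eq_false_of_guard (ops : List (ClOp ι)) (w : ι → Bool) (i : ι)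
    (h : ∀ op ∈ ops, op.guard w = false) : clToggle ops w i = false := by
  induction ops with
  | nil => rfl
  | cons op ops ih =>
    rw [clToggle_cons, ih fun op' hop' => h op' (List.mem_cons_of_mem _ hop'), h op (by simp)]
    simp

/-- If exactly one operation of the program targets its target (targets without
duplicates), the toggle of that target is the guard of that operation. [folklore] -/
theorem clToggle_eq_guard_of_nodup (ops : List (ClOp ι)) (w : ι → Bool)
    (hnd : (ops.map ClOp.target).Nodup) {op : ClOp ι} (hop : op ∈ ops) :
    clToggle ops w op.target = op.guard w := by
  induction ops with
  | nil => simp at hop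
  | cons op' ops ih =>
    rw [List.map_cons, List.nodup_cons] at hnd
    rw [clToggle_cons]
    rcases List.mem_cons.1 hop with rfl | hop
    · rw [clToggle_eq_false_of_forall_ne ops w (i := op.target)]
      · simp
      · intro op'' hop'' e
        exact hnd.1 (e ▸ List.mem_map_of_mem hop'')
    · have hne : op'.target ≠ op.target := fun e =>
        hnd.1 (e ▸ List.mem_map_of_mem hop)
      rw [ih hnd.2 hop]
      simp [hne]

/-- **Programs whose targets are never controls.** If no target of the program is a control
of the program, then all guards keep their initial values during the execution, so every
wire ends up toggled by `clToggle ops w i` (the XOR of the initial guards of the operations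
targeting it). This is the bookkeeping behind "compute each gate into a fresh wire"
(Arora–Barak 2009, proof of Lemma 10.10). [cite: AroraBarakCC2009, §10.3.7 Lemma 10.10] -/
theorem clEval_apply_of_disjoint (ops : List (ClOp ι))
    (h : ∀ op ∈ ops, ∀ op' ∈ ops, op'.target ∉ op.controls) (w : ι → Bool) (i : ι) :
    clEval ops w i = (w i ^^ clToggle ops w i) := by
  induction ops generalizing w with
  | nil => simp
  | cons op ops ih =>
    rw [clEval_cons, ih (fun o ho o' ho' => h o (List.mem_cons_of_mem _ ho) o'
      (List.mem_cons_of_mem _ ho')), clToggle_cons, ClOp.eval_apply]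
    have hg : clToggle ops (op.eval w) i = clToggle ops w i := by
      refine clToggle_congr ops i fun o ho c hc => ClOp.eval_apply_of_ne op w ?_
      intro e
      exact h o (List.mem_cons_of_mem _ ho) op (by simp) (e ▸ hc)
    rw [hg]
    cases w i <;> cases (decide (op.target = i) && op.guard w) <;> cases clToggle ops w i <;> rfl

/-- If all guards are off initially and no target is a control, the program is the
identity. [folklore] -/
theorem clEval_eq_self_of_guard (ops : List (ClOp ι))
    (h : ∀ op ∈ ops, ∀ op' ∈ ops, op'.target ∉ op.controls) (w : ι → Bool)
    (hg : ∀ op ∈ ops, op.guard w = false) : clEval ops w = w := by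
  funext i
  rw [clEval_apply_of_disjoint ops h, clToggle_eq_false_of_guard ops w i hg]
  simp

/-- **Fresh distinct targets.** If no target is a control and the targets are pairwise
distinct, then the target of each operation ends up toggled by exactly its own (initial)
guard. [cite: AroraBarakCC2009, §10.3.7 Lemma 10.10] -/
theorem clEval_apply_target_of_nodup (ops : List (ClOp ι))
    (h : ∀ op ∈ ops, ∀ op' ∈ ops, op'.target ∉ op.controls)
    (hnd : (ops.map ClOp.target).Nodup) (w : ι → Bool) {op : ClOp ι} (hop : op ∈ ops) :
    clEval ops w op.target = (w op.target ^^ op.guard w) := by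
  rw [clEval_apply_of_disjoint ops h, clToggle_eq_guard_of_nodup ops w hnd hop]

/-! ### The conjunction chain: semantics -/

/-- A chain does not change wires outside its ancillas. [folklore] -/
theorem clEval_clChain_of_not_mem (a₀ : ι) (ls as : List ι) (w : ι → Bool) {i : ι}
    (hi : i ∉ as) : clEval (clChain a₀ ls as) w i = w i :=
  clEval_apply_of_forall_target_ne _ _ fun _ hop e => hi (e ▸ target_mem_of_mem_clChain hop)

/-- **The conjunction chain, all links.** With fresh ancillas (pairwise distinct, all `0`,
disjoint from the literals, at most as many as literals), the `i`-th ancilla ends up holding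
the conjunction of the seed and of the first `i + 1` literals. (No hypothesis on the seed is
needed: if the seed is an ancilla it is `0` and both sides vanish.)
[Nielsen–Chuang 2010, §3.2.5; Arora–Barak 2009, Lemma 10.10] [cite: NielsenChuang2010, §3.2.5] -/
theorem clEval_clChain_getElem (a₀ : ι) (ls as : List ι) (w : ι → Bool)
    (hlen : as.length ≤ ls.length) (hnd : as.Nodup) (hdisj : ∀ l ∈ ls, l ∉ as)
    (hz : ∀ a ∈ as, w a = false) (i : ℕ) (hi : i < as.length) :
    clEval (clChain a₀ ls as) w as[i] = (w a₀ && (ls.take (i + 1)).all w) := by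
  induction as generalizing a₀ ls w i with
  | nil => simp at hi
  | cons a as ih =>
    cases ls with
    | nil => simp at hlen
    | cons l ls =>
      simp only [List.length_cons, Nat.add_le_add_iff_right] at hlen
      rw [List.nodup_cons] at hnd
      have hla : l ≠ a := fun e => hdisj l (by simp) (e ▸ List.mem_cons_self ..)
      have hwa : (ClOp.toffoli a₀ l a).eval w a = (w a₀ && w l) := by
        rw [ClOp.eval_toffoli, update_self, hz a (by simp)]
        simp
      have hoff : ∀ j, j ≠ a → (ClOp.toffoli a₀ l a).eval w j = w j := fun j hj =>
        ClOp.eval_apply_of_ne _ _ (by exact hj)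
      rw [clChain_cons_cons, clEval_cons]
      cases i with
      | zero =>
        simp only [List.getElem_cons_zero, Nat.zero_add, List.take_succ_cons, List.take_zero,
          List.all_cons, List.all_nil, Bool.and_true]
        rw [clEval_clChain_of_not_mem _ _ _ _ hnd.1, hwa]
      | succ j =>
        simp only [List.getElem_cons_succ, List.take_succ_cons, List.all_cons]
        have hj : j < as.length := by simpa using hi
        rw [ih a ls _ hlen hnd.2 (fun l' hl' hmem => hdisj l' (by simp [hl'])
          (List.mem_cons_of_mem _ hmem)) (fun a' ha' => ?_) j hj]
        · rw [hwa, List.all_congr_of_forall_mem (fun l' hl' => hoff l' ?_)]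
          · cases w a₀ <;> cases w l <;> simp
          · intro e
            exact hdisj l' (by simp [List.mem_of_mem_take hl']) (e ▸ List.mem_cons_self ..)
        · rw [hoff a' (fun e => hnd.1 (e ▸ ha'))]
          exact hz a' (List.mem_cons_of_mem _ ha')

/-- **The conjunction chain.** With as many fresh ancillas as literals (ancillas pairwise
distinct, all `0`, disjoint from the literals), the last ancilla ends up holding
`w a₀ ∧ ⋀ᵢ w lᵢ`. [Nielsen–Chuang 2010, §3.2.5; Arora–Barak 2009, Lemma 10.10]
[cite: NielsenChuang2010, §3.2.5] -/
theorem clEval_clChain_getLast (a₀ : ι) (ls as : List ι) (w : ι → Bool)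
    (hlen : ls.length = as.length) (hne : as ≠ [])
    (hnd : as.Nodup) (hdisj : ∀ l ∈ ls, l ∉ as) (hz : ∀ a ∈ as, w a = false) :
    clEval (clChain a₀ ls as) w (as.getLast hne) = (w a₀ && ls.all w) := by
  have hpos : 0 < as.length := List.length_pos_of_ne_nil hne
  rw [List.getLast_eq_getElem, clEval_clChain_getElem a₀ ls as w hlen.ge hnd hdisj hz _
    (Nat.sub_lt hpos Nat.one_pos), Nat.sub_add_cancel hpos, ← hlen, List.take_length]

/-! ### Concatenations, negation layers, swaps -/

/-- `clToggle` of a concatenation. [folklore] -/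
theorem clToggle_append (ops ops' : List (ClOp ι)) (w : ι → Bool) (i : ι) :
    clToggle (ops ++ ops') w i = (clToggle ops w i ^^ clToggle ops' w i) := by
  induction ops with
  | nil => simp
  | cons op ops ih =>
    rw [List.cons_append, clToggle_cons, clToggle_cons, ih]
    cases (decide (op.target = i) && op.guard w) <;> cases clToggle ops w i <;>
      cases clToggle ops' w i <;> rfl

/-- `clToggle` of a `flatMap` all of whose chunks but one do not target `i`. [folklore] -/
theorem clToggle_flatMap_of_forall_ne {α : Type*} (l : List α) (f : α → List (ClOp ι))
    (w : ι → Bool) (i : ι) (a : α) (hl : l.Nodup) (ha : a ∈ l)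
    (h : ∀ a' ∈ l, a' ≠ a → ∀ op ∈ f a', op.target ≠ i) :
    clToggle (l.flatMap f) w i = clToggle (f a) w i := by
  induction l with
  | nil => simp at ha
  | cons b l ih =>
    rw [List.nodup_cons] at hl
    rw [List.flatMap_cons, clToggle_append]
    rcases List.mem_cons.1 ha with rfl | ha
    · rw [clToggle_eq_false_of_forall_ne (l.flatMap f) w (fun op hop => ?_), Bool.xor_false]
      obtain ⟨a', ha', hop⟩ := List.mem_flatMap.1 hop
      exact h a' (List.mem_cons_of_mem _ ha') (fun e => hl.1 (e ▸ ha')) op hop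
    · rw [ih hl.2 ha (fun a' ha' hne => h a' (List.mem_cons_of_mem _ ha') hne),
        clToggle_eq_false_of_forall_ne (f b) w (fun op hop => ?_), Bool.false_xor]
      exact h b (by simp) (fun e => hl.1 (e ▸ ha)) op hop

/-- `clToggle` of a `flatMap` none of whose chunks targets `i`. [folklore] -/
theorem clToggle_flatMap_eq_false {α : Type*} (l : List α) (f : α → List (ClOp ι))
    (w : ι → Bool) (i : ι) (h : ∀ a ∈ l, ∀ op ∈ f a, op.target ≠ i) :
    clToggle (l.flatMap f) w i = false :=
  clToggle_eq_false_of_forall_ne _ w fun op hop => by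
    obtain ⟨a, ha, hop⟩ := List.mem_flatMap.1 hop
    exact h a ha op hop

/-- **Three `CNOT`s swap two wires**: after `CNOT a z; CNOT z a; CNOT a z` wire `z` holds the
old value of wire `a`. [Nielsen–Chuang 2010, §1.3.4 (swap from three CNOTs)]
[cite: NielsenChuang2010, §1.3.4] -/
theorem clEval_swap_apply (a z : ι) (haz : a ≠ z) (w : ι → Bool) :
    clEval [ClOp.cnot a z, ClOp.cnot z a, ClOp.cnot a z] w z = w a := by
  simp only [clEval_cons, clEval_nil, ClOp.eval_cnot, update_self, update_of_ne haz,
    update_of_ne haz.symm]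
  cases w a <;> cases w z <;> rfl

/-- Negations on pairwise distinct wires flip the listed wires. [folklore] -/
theorem clEval_map_not_of_mem (L : List ι) (hL : L.Nodup)
    (w : ι → Bool) {i : ι} (hi : i ∈ L) : clEval (L.map ClOp.not) w i = !w i := by
  induction L generalizing w with
  | nil => simp at hi
  | cons a L ih =>
    rw [List.nodup_cons] at hL
    rw [List.map_cons, clEval_cons, ClOp.eval_not]
    rcases List.mem_cons.1 hi with rfl | hi'
    · rw [clEval_apply_of_forall_target_ne _ _ fun op hop e => hL.1 ?_, update_self]
      obtain ⟨a', ha', rfl⟩ := List.mem_map.1 hop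
      exact e ▸ ha'
    · have hia : i ≠ a := fun e => hL.1 (e ▸ hi')
      rw [ih hL.2 _ hi', update_of_ne hia]

/-- Negations on pairwise distinct wires do not touch the other wires. [folklore] -/
theorem clEval_map_not_of_not_mem (L : List ι) (w : ι → Bool)
    {i : ι} (hi : i ∉ L) : clEval (L.map ClOp.not) w i = w i :=
  clEval_apply_of_forall_target_ne _ _ fun op hop e => hi <| by
    obtain ⟨a, ha, rfl⟩ := List.mem_map.1 hop
    exact e ▸ ha

end Programs

/-! ### Re-indexing programs -/

section Map

variable {ι κ : Type*} [DecidableEq ι] [DecidableEq κ]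

/-- **Transport along an injective re-indexing**: on the image wires, the re-indexed
program computes the original program on the pulled-back assignment. [folklore] -/
theorem clEval_map_comp {f : ι → κ} (hf : Function.Injective f) (ops : List (ClOp ι))
    (w : κ → Bool) : clEval (ops.map (ClOp.map f)) w ∘ f = clEval ops (w ∘ f) := by
  induction ops generalizing w with
  | nil => rfl
  | cons op ops ih =>
    rw [List.map_cons, clEval_cons, clEval_cons, ih, ClOp.eval_map_comp hf]

/-- Pointwise form of `clEval_map_comp`. [folklore] -/
theorem clEval_map_apply {f : ι → κ} (hf : Function.Injective f) (ops : List (ClOp ι))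
    (w : κ → Bool) (i : ι) : clEval (ops.map (ClOp.map f)) w (f i) = clEval ops (w ∘ f) i :=
  congrFun (clEval_map_comp hf ops w) i

omit [DecidableEq ι] in
/-- A re-indexed program does not touch wires outside the image. [folklore] -/
theorem clEval_map_apply_of_not_mem_range (f : ι → κ) (ops : List (ClOp ι)) (w : κ → Bool)
    {j : κ} (hj : j ∉ Set.range f) : clEval (ops.map (ClOp.map f)) w j = w j := by
  refine clEval_apply_of_forall_target_ne _ _ fun op hop e => hj ?_
  obtain ⟨op', -, rfl⟩ := List.mem_map.1 hop
  exact ⟨op'.target, by rw [← e, ClOp.target_map]⟩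

/-- **Transport along an equivalence of wire types.** [folklore] -/
theorem clEval_map_equiv (e : ι ≃ κ) (ops : List (ClOp ι)) (w : κ → Bool) :
    clEval (ops.map (ClOp.map e)) w = clEval ops (w ∘ e) ∘ e.symm := by
  funext j
  have := clEval_map_apply e.injective ops w (e.symm j)
  rw [Equiv.apply_symm_apply] at this
  exact this

end Map

/-! ### Reversibility -/

section Reversible

variable {ι : Type*} [DecidableEq ι]

/-- A program of well-formed operations is injective on assignments (each operation is an
involution). [Nielsen–Chuang 2010, §3.2.5] [cite: NielsenChuang2010, §3.2.5] -/
theorem clEval_injective (ops : List (ClOp ι)) (h : ∀ op ∈ ops, op.WF) :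
    Function.Injective (clEval ops) := by
  induction ops with
  | nil => exact fun a b h => h
  | cons op ops ih =>
    intro a b hab
    have h1 := ih (fun o ho => h o (List.mem_cons_of_mem _ ho)) hab
    exact (ClOp.eval_involutive (h op (by simp))).injective h1

end Reversible

/-! ### Bridge to `RevOp` and `revCompile` -/

section ToRev

open Cryptography

variable {N : ℕ}

/-- A well-formed classical operation on `Fin N` as a reversible operation of
`ReversibleCliffordT` (the distinctness proofs are the well-formedness). [folklore] -/
def ClOp.toRev : (op : ClOp (Fin N)) → op.WF → RevOp N
  | .not i, _ => .not i
  | .cnot i j, h => .cnot i j h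
  | .toffoli a b c, h => .toffoli a b c h.1 h.2.1 h.2.2

/-- `toRev` preserves the semantics. [folklore] -/
theorem ClOp.eval_toRev (op : ClOp (Fin N)) (h : op.WF) (w : QReg N) :
    (op.toRev h).eval w = op.eval w := by
  cases op with
  | not i => simp [ClOp.toRev, RevOp.eval, ClOp.eval, ClOp.target, ClOp.guard]
  | cnot i j => rfl
  | toffoli a b c => rfl

/-- A program of well-formed operations as a reversible circuit. [folklore] -/
def toRevList : (ops : List (ClOp (Fin N))) → (∀ op ∈ ops, op.WF) → List (RevOp N)
  | [], _ => []
  | op :: ops, h => op.toRev (h op (by simp)) :: toRevList ops (fun o ho => h o (by simp [ho]))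

/-- **`toRevList` preserves the semantics**: `revEval (toRevList ops h) = clEval ops`, so
`revCompile (toRevList ops h)` is a Clifford+T circuit acting on basis states by `clEval ops`
(`revCompile_mulVec_basisState`). [folklore] -/
theorem revEval_toRevList : ∀ (ops : List (ClOp (Fin N))) (h : ∀ op ∈ ops, op.WF) (w : QReg N),
    revEval (toRevList ops h) w = clEval ops w
  | [], _, _ => rfl
  | op :: ops, h, w => by
    rw [toRevList, revEval, clEval_cons, ClOp.eval_toRev]
    exact revEval_toRevList ops _ _

/-- `toRevList` preserves the length. [folklore] -/
theorem length_toRevList : ∀ (ops : List (ClOp (Fin N))) (h : ∀ op ∈ ops, op.WF),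
    (toRevList ops h).length = ops.length
  | [], _ => rfl
  | _ :: ops, _ => congrArg Nat.succ (length_toRevList ops _)

end ToRev

end Literature.Computability.QuantumComplexity
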